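import Mathlib
import HarnessLib
import Summits.HubbardSuperconductivity.HubbardSuperconductivity.Theorems.KLProgrammeKLRegimeVolumeLimitV11HinstDoors

/-!
# Route `KLProgramme` — crux K3, VL child `KLRegimeVolumeLimitV17F2` (stmt-HubbardSuperconductivity-20440), skeleton «cauchy» v11: THE `hSup` DISCHARGER,
# part 4 — THE ATOM `Hcov` FROM p3's ALL-STEPS DOORS AND THE SCALE-0 LANE'S `j = 0` BUNDLES (seat hubbard-kl-k3c4-p1 g16; `--supports` 20440)

`…V11HSupOfAtoms.hSupRegBody_of_atoms` takes the covariance/sectional/transfer data of ALL steps `j < n_β` as ONE atom `Hcov` («post-tower instance» shape).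
Its steps `j ≥ 1` are p3's landed doors (`…V11HinstDoors.towerDoors_of_towerP`); its step `j = 0` is the scale-0 lane's located item «SCALE-0-STEPCOV» (p3 g17:
`scaleCovData_/scaleCovSecData_klStepCov_zero_flow_all`).  This file states the `j = 0` input as the atom **`H0`** (same «post-tower instance» shape: constants
`κ₀, α₀, s₀, e₀, ρ₀`; for `1 ≤ n_β`, at rate `Λ` with `Λ·4^{n_β+1} ≤ ρ₀`, the bundles of `klStepCov V M β μ K_V 0` at the three placements `(L, K_L)`, `(bL, K_{bL})`,
`(bL, K_L)` with row constant `α₀/ε_M` and the sectional row `e₀` of `klStepCov (bL) M β μ K_L 0`) and MERGES: `k := max k₁ κ₀`, `a := max a₁ α₀`, `s := max s₁ s₀`,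
`e := max e₁ e₀`, `ρ := min ρ ρ₀` (`scaleCovData_mono'`, `scaleCovSecData_mono`), thresholds `c₇ := min (klEngC₃6 P R) c₇⁰`,
`U₇ := min (min (klEngU₀3 P R c) (1/(R.Gfr 3+1))) (min (klEngU₀4 P R c) U₇⁰)`, `L₂ := max Lstar (klEngL₃ β U) ⊔ L₂⁰`, `M₂ L b := …`.

* **`hcov_of_doors_and_scaleZero`** — `H0 → Hcov` (for every `(G, P, Q, R)` with `R.WF2`).

Proofs only; no definition.  Honest framing: plumbing; nothing here asserts `H0`, any stub, K3, VL or superconductivity.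
[cite: BenfattoGiulianiMastropietro2006, §2.7 (2.70)–(2.71a), §2.8 (2.80)–(2.81), §3 (3.2)–(3.8)]
-/

noncomputable section

namespace Summit.HubbardSuperconductivity.HubbardSuperconductivity.Theorems.TwoVolumeSource

set_option linter.dupNamespace false -- summit = problem name (single-conjunct summit), D-0017

open Finset Filter Topology Literature.MathematicalPhysics.QuantumLattice GrassmannAlgebra Literature.Probability.LatticeModels
  Literature.Probability.LatticeModels.BattleFederbush
open Summit.HubbardSuperconductivity.HubbardSuperconductivity.Theorems.KLRegimeSplit
open Summit.HubbardSuperconductivity.HubbardSuperconductivity.Theorems.KLProgrammeLegKernels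
open Summit.HubbardSuperconductivity.HubbardSuperconductivity.Theorems.TwoPointAssembly
open Summit.HubbardSuperconductivity.HubbardSuperconductivity.Theorems.EngineV8
open Summit.HubbardSuperconductivity.HubbardSuperconductivity.Theorems.TwoVolumeDefect
open Summit.HubbardSuperconductivity.HubbardSuperconductivity.Theorems.TorusFourierL2

/-- The merged Gram law dominates the doors' one: `√(k₁²·8^{−j}) ≤ √((max k₁ κ₀)²·8^{−j})` (`0 ≤ k₁`). [folklore] -/
theorem sqrt_sq_mul_le_sqrt_max_sq_mul {k₁ κ₀ : ℝ} (hk₁ : 0 ≤ k₁) (j : ℕ) :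
    Real.sqrt (k₁ ^ 2 * ((8 : ℝ) ^ j)⁻¹) ≤ Real.sqrt ((max k₁ κ₀) ^ 2 * ((8 : ℝ) ^ j)⁻¹) :=
  Real.sqrt_le_sqrt (mul_le_mul_of_nonneg_right (pow_le_pow_left₀ hk₁ (le_max_left _ _) 2) (by positivity))

/-- The merged Gram law dominates the scale-0 constant: `κ₀ ≤ √((max k₁ κ₀)²·8^{−0})` (`0 ≤ κ₀`). [folklore] -/
theorem le_sqrt_max_sq_zero {k₁ κ₀ : ℝ} (hκ₀ : 0 ≤ κ₀) : κ₀ ≤ Real.sqrt ((max k₁ κ₀) ^ 2 * ((8 : ℝ) ^ (0 : ℕ))⁻¹) := by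
  rw [pow_zero, inv_one, mul_one, Real.sqrt_sq (hκ₀.trans (le_max_right _ _))]
  exact le_max_right _ _

set_option maxHeartbeats 3200000 in -- long binders
/-- **`H0 → Hcov`** (see the module docstring). [folklore: composition; cite: BenfattoGiulianiMastropietro2006, §2.7 (2.70)–(2.71a), §2.8 (2.80)–(2.81), §3 (3.2)–(3.8)] -/
theorem hcov_of_doors_and_scaleZero
    (H0 : ∀ (G : GeoConsts) (P : SplitConsts) (Q : EngConsts) (R : RenConsts), G.WF → P.WF → Q.WF → R.WF2 →
      ∃ κ₀ α₀ s₀ e₀ ρ₀ : ℝ, 0 < κ₀ ∧ 0 < α₀ ∧ 0 ≤ s₀ ∧ 0 ≤ e₀ ∧ 0 < ρ₀ ∧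
        ∃ c₇ : ℝ, 0 < c₇ ∧ ∀ c : ℝ, 0 < c → c ≤ c₇ → ∃ U₇ : ℝ, 0 < U₇ ∧
          ∀ μ ∈ klWindowC, ∀ U : ℝ, 0 < U → U ≤ U₇ → ∀ β : ℝ, klBetaMin ≤ β → β ≤ Real.exp (c / U ^ 2) →
            ∀ (K : TrigPolyC4v) (Lstar : ℕ) (Mstar : ℕ → ℕ), TowerP klPredsV17F2 G P Q R β U μ K Lstar Mstar →
            ∀ Λ : ℝ, 0 ≤ Λ → Λ * (4 : ℝ) ^ (nScales β + 1) ≤ ρ₀ → 1 ≤ nScales β →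
            ∃ L₂ : ℕ, ∃ M₂ : ℕ → ℕ → ℕ, ∀ (L b M : ℕ) [NeZero L] [NeZero (b * L)] [NeZero M], L₂ ≤ L → M₂ L b ≤ M →
              ScaleCovData (klStepCov L M β μ (klFlowFrameU L M β U μ (nScales β + 1)) 0) Λ κ₀ (α₀ / imagTimeWeight β M) s₀ ∧
              ScaleCovData (klStepCov (b * L) M β μ (klFlowFrameU (b * L) M β U μ (nScales β + 1)) 0) Λ κ₀ (α₀ / imagTimeWeight β M) s₀ ∧
              ScaleCovData (klStepCov (b * L) M β μ (klFlowFrameU L M β U μ (nScales β + 1)) 0) Λ κ₀ (α₀ / imagTimeWeight β M) s₀ ∧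
              ScaleCovSecData (klStepCov (b * L) M β μ (klFlowFrameU L M β U μ (nScales β + 1)) 0) Λ e₀)
    (G : GeoConsts) (P : SplitConsts) (Q : EngConsts) (R : RenConsts) (hG : G.WF) (hP : P.WF) (hQ : Q.WF) (hR2 : R.WF2) :
      ∃ k₁ a₁ s₁ e₁ w₁ ρ : ℝ, 0 < k₁ ∧ 0 < a₁ ∧ 0 ≤ s₁ ∧ 0 ≤ e₁ ∧ 1 ≤ w₁ ∧ 0 < ρ ∧
        ∃ c₇ : ℝ, 0 < c₇ ∧ ∀ c : ℝ, 0 < c → c ≤ c₇ → ∃ U₇ : ℝ, 0 < U₇ ∧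
          ∀ μ ∈ klWindowC, ∀ U : ℝ, 0 < U → U ≤ U₇ → ∀ β : ℝ, klBetaMin ≤ β → β ≤ Real.exp (c / U ^ 2) →
            ∀ (K : TrigPolyC4v) (Lstar : ℕ) (Mstar : ℕ → ℕ), TowerP klPredsV17F2 G P Q R β U μ K Lstar Mstar →
            ∀ Λ : ℝ, 0 ≤ Λ → Λ ≤ klScale klE0 (nScales β + 1) → Λ * (4 : ℝ) ^ (nScales β + 1) ≤ ρ →
            ∃ L₂ : ℕ, ∃ M₂ : ℕ → ℕ → ℕ, ∀ (L b M : ℕ) [NeZero L] [NeZero (b * L)] [NeZero M], L₂ ≤ L → M₂ L b ≤ M →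
              (∀ j, j < nScales β → ScaleCovData (klStepCov L M β μ (klFlowFrameU L M β U μ (nScales β + 1)) j) Λ (Real.sqrt (k₁ ^ 2 * ((8 : ℝ) ^ j)⁻¹))
                (a₁ * (4 : ℝ) ^ j / imagTimeWeight β M) s₁) ∧
              (∀ j, j < nScales β → ScaleCovData (klStepCov (b * L) M β μ (klFlowFrameU (b * L) M β U μ (nScales β + 1)) j) Λ (Real.sqrt (k₁ ^ 2 * ((8 : ℝ) ^ j)⁻¹))
                (a₁ * (4 : ℝ) ^ j / imagTimeWeight β M) s₁) ∧
              (∀ j, j < nScales β → ScaleCovData (klStepCov (b * L) M β μ (klFlowFrameU L M β U μ (nScales β + 1)) j) Λ (Real.sqrt (k₁ ^ 2 * ((8 : ℝ) ^ j)⁻¹))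
                (a₁ * (4 : ℝ) ^ j / imagTimeWeight β M) s₁) ∧
              (∀ j, j < nScales β → ScaleCovSecData (klStepCov (b * L) M β μ (klFlowFrameU L M β U μ (nScales β + 1)) j) Λ e₁) ∧
              (∀ j, j ≤ nScales β → TransferWtData (klTowerTransfer (b * L) M β μ (klFlowFrameU L M β U μ (nScales β + 1)) j)
                (klBlockEquivD L b M j) (klBlockEquivD L b M (j - 1)) Λ w₁) := by
  obtain ⟨k₁, a₁, s₁, e₁, w₁, ρ, hk₁, ha₁, hs₁, he₁, hw₁, hρ, hdoors⟩ := towerDoors_of_towerP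
  obtain ⟨κ₀, α₀, s₀, e₀, ρ₀, hκ₀, hα₀, hs₀, he₀, hρ₀, c₀, hc₀, h0⟩ := H0 G P Q R hG hP hQ hR2
  refine ⟨max k₁ κ₀, max a₁ α₀, max s₁ s₀, max e₁ e₀, w₁, min ρ ρ₀, lt_max_of_lt_left hk₁, lt_max_of_lt_left ha₁, le_max_of_le_left hs₁.le,
    le_max_of_le_left he₁.le, hw₁, lt_min hρ hρ₀, min (klEngC₃6 P R) c₀, lt_min (klEngC₃6_pos P R) hc₀, fun c hc hcc => ?_⟩
  obtain ⟨U₀, hU₀, h0c⟩ := h0 c hc (hcc.trans (min_le_right _ _))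
  refine ⟨min (min (klEngU₀3 P R c) (1 / (R.Gfr 3 + 1))) (min (klEngU₀4 P R c) U₀),
    lt_min (lt_min (klEngU₀3_pos P R c) (by have := hR2.wf.2.2 3; positivity)) (lt_min (klEngU₀4_pos P R c) hU₀),
    fun μ hμ U hU hUU β hβmin hβc K Lstar Mstar hT Λ hΛ0 hΛle hΛρ => ?_⟩
  have hU3 : U ≤ min (klEngU₀3 P R c) (1 / (R.Gfr 3 + 1)) := hUU.trans (min_le_left _ _)
  have hU4 : U ≤ klEngU₀4 P R c := hUU.trans ((min_le_right _ _).trans (min_le_left _ _))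
  have hUU₀ : U ≤ U₀ := hUU.trans ((min_le_right _ _).trans (min_le_right _ _))
  have hβ : 0 < β := KLRegimeSplit.pos_of_klBetaMin_le hβmin
  have h0I' : ∃ L₂ : ℕ, ∃ M₂ : ℕ → ℕ → ℕ, ∀ (L b M : ℕ) [NeZero L] [NeZero (b * L)] [NeZero M], L₂ ≤ L → M₂ L b ≤ M → 1 ≤ nScales β →
      ScaleCovData (klStepCov L M β μ (klFlowFrameU L M β U μ (nScales β + 1)) 0) Λ κ₀ (α₀ / imagTimeWeight β M) s₀ ∧
      ScaleCovData (klStepCov (b * L) M β μ (klFlowFrameU (b * L) M β U μ (nScales β + 1)) 0) Λ κ₀ (α₀ / imagTimeWeight β M) s₀ ∧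
      ScaleCovData (klStepCov (b * L) M β μ (klFlowFrameU L M β U μ (nScales β + 1)) 0) Λ κ₀ (α₀ / imagTimeWeight β M) s₀ ∧
      ScaleCovSecData (klStepCov (b * L) M β μ (klFlowFrameU L M β U μ (nScales β + 1)) 0) Λ e₀ := by
    by_cases hN : 1 ≤ nScales β
    · obtain ⟨L₂, M₂, h⟩ := h0c μ hμ U hU hUU₀ β hβmin hβc K Lstar Mstar hT Λ hΛ0 (hΛρ.trans (min_le_right _ _)) hN
      exact ⟨L₂, M₂, fun L b M _ _ _ hL hM _ => h L b M hL hM⟩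
    · exact ⟨0, fun _ _ => 0, fun L b M _ _ _ _ _ h => absurd h hN⟩
  obtain ⟨L₂, M₂, h0I⟩ := h0I'
  have hD := hdoors G P Q R c hP hR2 hc (hcc.trans (min_le_left _ _)) μ hμ U hU hU3 hU4 β hβmin hβc K Lstar Mstar hT Λ hΛ0 hΛle
    (hΛρ.trans (min_le_left _ _))
  refine ⟨max (max Lstar (klEngL₃ β U)) L₂, fun L b => max (max (max (Mstar L) (Mstar (b * L))) (max (klEngM₃ β U L) (klEngM₃ β U (b * L)))) (M₂ L b),
    fun L b M _ _ _ hL hM => ?_⟩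
  dsimp only at hM
  have hLs : Lstar ≤ L := by omega
  have hL3 : klEngL₃ β U ≤ L := by omega
  have hL₂ : L₂ ≤ L := by omega
  have hMs : Mstar L ≤ M := by omega
  have hMsb : Mstar (b * L) ≤ M := by omega
  have hM3 : klEngM₃ β U L ≤ M := by omega
  have hM3b : klEngM₃ β U (b * L) ≤ M := by omega
  have hM₂ : M₂ L b ≤ M := by omega
  obtain ⟨hc1, hc2, hc3, hsec, htr⟩ := hD L b M hLs hL3 hMs hMsb hM3 hM3b
  -- the monotonicity conversions
  have hεpos : 0 < imagTimeWeight β M := by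
    have hMβ : β ≤ (M : ℝ) := le_of_klEngM₃_le hβmin hL3 hM3
    have hM0 : (0 : ℝ) < M := lt_of_lt_of_le hβ hMβ
    show 0 < β / (2 * M)
    positivity
  have hconv1 : ∀ {V : ℕ} [NeZero V] {Kx : TrigPolyC4v} (j : ℕ),
      ScaleCovData (klStepCov V M β μ Kx j) Λ (Real.sqrt (k₁ ^ 2 * ((8 : ℝ) ^ j)⁻¹)) (a₁ * (4 : ℝ) ^ j / imagTimeWeight β M) s₁ →
      ScaleCovData (klStepCov V M β μ Kx j) Λ (Real.sqrt ((max k₁ κ₀) ^ 2 * ((8 : ℝ) ^ j)⁻¹)) (max a₁ α₀ * (4 : ℝ) ^ j / imagTimeWeight β M) (max s₁ s₀) :=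
    fun j h => scaleCovData_mono' h (sqrt_sq_mul_le_sqrt_max_sq_mul hk₁.le j)
      (div_le_div_of_nonneg_right (mul_le_mul_of_nonneg_right (le_max_left _ _) (by positivity)) hεpos.le) (le_max_left _ _)
  have hconv0 : ∀ {V : ℕ} [NeZero V] {Kx : TrigPolyC4v},
      ScaleCovData (klStepCov V M β μ Kx 0) Λ κ₀ (α₀ / imagTimeWeight β M) s₀ →
      ScaleCovData (klStepCov V M β μ Kx 0) Λ (Real.sqrt ((max k₁ κ₀) ^ 2 * ((8 : ℝ) ^ (0 : ℕ))⁻¹)) (max a₁ α₀ * (4 : ℝ) ^ (0 : ℕ) / imagTimeWeight β M)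
        (max s₁ s₀) :=
    fun h => scaleCovData_mono' h (le_sqrt_max_sq_zero hκ₀.le)
      (div_le_div_of_nonneg_right (by rw [pow_zero, mul_one]; exact le_max_right _ _) hεpos.le) (le_max_right _ _)
  refine ⟨fun j hj => ?_, fun j hj => ?_, fun j hj => ?_, fun j hj => ?_, htr⟩
  · rcases Nat.eq_zero_or_pos j with rfl | hj1
    · exact hconv0 (h0I L b M hL₂ hM₂ (by omega)).1
    · exact hconv1 j (hc1 j hj1 hj)
  · rcases Nat.eq_zero_or_pos j with rfl | hj1
    · exact hconv0 (h0I L b M hL₂ hM₂ (by omega)).2.1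
    · exact hconv1 j (hc2 j hj1 hj)
  · rcases Nat.eq_zero_or_pos j with rfl | hj1
    · exact hconv0 (h0I L b M hL₂ hM₂ (by omega)).2.2.1
    · exact hconv1 j (hc3 j hj1 hj)
  · rcases Nat.eq_zero_or_pos j with rfl | hj1
    · exact scaleCovSecData_mono (h0I L b M hL₂ hM₂ (by omega)).2.2.2 (le_max_right _ _)
    · exact scaleCovSecData_mono (hsec j hj1 hj) (le_max_left _ _)

end Summit.HubbardSuperconductivity.HubbardSuperconductivity.Theorems.TwoVolumeSource

end
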